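/-
Copyright (c) 2026 the pub-hodgecm-mathlib formalisation cell (harness21).  Prover seat hodgecm-mathlib-K2Liu-p09 (g0): Track B «K2-LIT»,
#184♮ = hLiu418 = stmt-HodgeConjecture-24832, file #9 of the K2_Liu road, organ (III-b) step E5′ (B3a: the unipotent chart `υ`); 2026-09-04.
-/
import Summits.HodgeConjecture.HodgeConjecture.Theorems.K2LiuSiegelDoubledLeviChart      -- ★ the Siegel–Levi chart, `exists_levi…`
import Literature.NumberTheory.Automorphic.SiegelShellDomination                         -- ★ `scalarExp`
import Literature.NumberTheory.Automorphic.UnitaryGroupHeisenbergRing                      -- ★ `HeisRing.map_invOf_two`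
import HarnessLib

/-!
# Crux `HLiu418`, Track B road `K2_Liu`, unit U3a «SIEGEL EISENSTEIN SERIES», file #9 — helper 16 (organ (III-b), step E5′, part B3a):
# the unipotent chart `υ : M_n(𝔸_L) → N_Δ(𝔸)` of the Siegel parabolic and the action of the split centre on it

Cell `hodgecm-mathlib`, crux item hLiu418 = `stmt-HodgeConjecture-24832`; squad K2 ∕ K2Liu, prover K2Liu-p09 (g0).  THEOREMS ONLY («characterisation
as interface»: `υ` is produced existentially); lane `--supports stmt-HodgeConjecture-24832` (count-neutral helper toward the hypotheses `hCN`, `hscale` of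
★ `godement_parabolic_integral` for `P_Δ(𝔸)`, PLAN v3 §B2–B3, socket #9 `sig_K2LiuSiegelEisensteinDoubledSummable`).

§1 (any commutative ring `R` with `⅟2`, involution `σ`, invertible symmetric `σ`-fixed `T`): the `T`-skew matrices `σ(Y)ᵀ T + T Y = 0` are the fixed
points of the `σ`-semilinear involution `ι X = −T⁻¹ σ(X)ᵀ T`; the projection `π X = ½ (X + ι X)` is additive, `R^σ`-linear, the identity on skew
matrices, kills `d • Y` (`Y` skew, `σ d = −d`), and `X = π X + δ π(δ' X)` for `σ δ = −δ`, `σ δ' = −δ'`, `δ δ' = 1` (the SQUARING decomposition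
`M_n = S ⊕ δ S`); and `m(A', D') n(Y) m(A, D) = n(A' Y D)` for `A' A = D' D = 1`.  (All maps written out; no definition.)
§2 (`H(𝔸)`): for the Siegel–Levi chart `(M_Δ, N_Δ, e, φ)` of ★ `exists_siegelLeviChart` (taken as HYPOTHESES through its characterisation),
**`exists_unipotentChart`**: a continuous `υ : M_n(𝔸_L) → N_Δ` with `υ (X + X') = υ X · υ X'`, `blkB (blk (υ X)) = π X`, `υ (blkB (blk u)) = u`
on `N_Δ`, and the CENTRE ACTION `(φ z(eˢ))⁻¹ · υ X · φ z(eˢ) = υ (c_s⁻¹ • X)`, `c_s = r · (c ⊗ 1)(r)`, `r = z(eˢ) ∈ 𝔸_Lˣ`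
[HarrisKudlaSweet1996 §1 (1.12): `n(b)`, `m(a) n(b) m(a)⁻¹ = n(a b a*)`].

HONEST LABEL.  Count-neutral helper of the K2_Liu road; it retires nothing by itself: `HC_CM` is proved only modulo the 7 printed
citations (2 remaining named inputs: hLiu418 = `stmt-HodgeConjecture-24832`, h413 = `stmt-HodgeConjecture-24833`) until rung 0 closes.

## References
* [HarrisKudlaSweet1996] M. Harris, S. S. Kudla, W. J. Sweet, J. Amer. Math. Soc. 9 (1996), §1 (1.11)–(1.12).
* [Garrett2018] P. Garrett, *Modern Analysis of Automorphic Forms by Example* (2018), §3.10.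
-/

set_option autoImplicit false
-- the mandated namespace repeats the single-problem summit's segment (`HodgeConjecture.HodgeConjecture`)
set_option linter.dupNamespace false

noncomputable section

open scoped Matrix NNReal
open NumberField IsDedekindDomain

namespace Summit.HodgeConjecture.HodgeConjecture.Cruxes.HLiu418.K2LiuSiegelDoubledUnipotentChart

open Literature.NumberTheory.GelbartRogawski1991.AdaptedBlocks
open Literature.NumberTheory.Automorphic Literature.NumberTheory.Automorphic.UnitaryGroup
open Literature.NumberTheory.GelbartRogawski1991 Literature.NumberTheory.GelbartRogawski1991.GRConstruction
open Literature.NumberTheory.K2Lit.SiegelDoubled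
open UnitaryDualPair
open Summit.HodgeConjecture.HodgeConjecture.Cruxes.HLiu418.K2LiuSiegelDoubledLeviAlgebra
open Summit.HodgeConjecture.HodgeConjecture.Cruxes.HLiu418.K2LiuSiegelDoubledBlkUnitary
open Summit.HodgeConjecture.HodgeConjecture.Cruxes.HLiu418.K2LiuSiegelDoubledLeviMatrix
open Summit.HodgeConjecture.HodgeConjecture.Cruxes.HLiu418.K2LiuSiegelDoubledLeviChart

/-! ## §1 Skew matrices, the projection `π X = ½ (X − T⁻¹ σ(X)ᵀ T)`, and the squaring decomposition -/

section Ring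

variable {R : Type*} [CommRing R] {ι : Type*} [Fintype ι] [DecidableEq ι] {σ : R →+* R} {T : Matrix ι ι R}

omit [Fintype ι] [DecidableEq ι] in
/-- `σ(c • X) = σ(c) • σ(X)` entrywise. [folklore] -/
theorem map_smul_eq (c : R) (X : Matrix ι ι R) : (c • X).map σ = σ c • X.map σ := by
  ext i j; simp

/-- **Skew ⟺ fixed by `ι`**: `σ(Y)ᵀ T + T Y = 0 ↔ Y = −(T⁻¹ σ(Y)ᵀ T)`. [cite: HarrisKudlaSweet1996, §1 (1.12)] -/
theorem skew_iff_eq_neg (hT : IsUnit T.det) (Y : Matrix ι ι R) :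
    (Y.map σ)ᵀ * T + T * Y = 0 ↔ Y = -(T⁻¹ * (Y.map σ)ᵀ * T) := by
  constructor
  · intro h
    have h1 : T * Y = -((Y.map σ)ᵀ * T) := eq_neg_of_add_eq_zero_right h
    calc Y = T⁻¹ * (T * Y) := by rw [← Matrix.mul_assoc, Matrix.nonsing_inv_mul T hT, Matrix.one_mul]
      _ = -(T⁻¹ * (Y.map σ)ᵀ * T) := by rw [h1, Matrix.mul_neg, Matrix.mul_assoc]
  · intro h
    have h1 : T * Y = -((Y.map σ)ᵀ * T) := by
      calc T * Y = T * -(T⁻¹ * (Y.map σ)ᵀ * T) := by rw [← h]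
        _ = -((Y.map σ)ᵀ * T) := by
            rw [Matrix.mul_neg, Matrix.mul_assoc T⁻¹, ← Matrix.mul_assoc T, Matrix.mul_nonsing_inv T hT, Matrix.one_mul]
    rw [h1, add_neg_cancel]

omit [DecidableEq ι] in
/-- `ι` is additive. [folklore] -/
theorem negConj_add [DecidableEq ι] (X X' : Matrix ι ι R) :
    -(T⁻¹ * ((X + X').map σ)ᵀ * T) = -(T⁻¹ * (X.map σ)ᵀ * T) + -(T⁻¹ * (X'.map σ)ᵀ * T) := by
  rw [Matrix.map_add _ (map_add σ), Matrix.transpose_add, Matrix.mul_add, Matrix.add_mul, neg_add]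

/-- `ι` is `σ`-semilinear. [folklore] -/
theorem negConj_smul (c : R) (X : Matrix ι ι R) :
    -(T⁻¹ * ((c • X).map σ)ᵀ * T) = σ c • -(T⁻¹ * (X.map σ)ᵀ * T) := by
  rw [map_smul_eq, Matrix.transpose_smul, Matrix.mul_smul, Matrix.smul_mul, smul_neg]

/-- `ι` is an involution (for `σ` an involution, `T` symmetric and `σ`-fixed). [folklore] -/
theorem negConj_negConj (hT : IsUnit T.det) (hTσ : T.map σ = T) (hTt : Tᵀ = T) (hσ : ∀ x, σ (σ x) = x) (X : Matrix ι ι R) :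
    -(T⁻¹ * ((-(T⁻¹ * (X.map σ)ᵀ * T)).map σ)ᵀ * T) = X := by
  have h1 : ((T⁻¹ * (X.map σ)ᵀ * T).map σ)ᵀ = T * X * T⁻¹ := by
    rw [Matrix.map_mul, Matrix.map_mul, map_nonsing_inv_eq hT hTσ, hTσ, Matrix.transpose_map, map_map_of_involutive hσ,
      Matrix.transpose_mul, Matrix.transpose_mul, Matrix.transpose_transpose, hTt, Matrix.transpose_nonsing_inv, hTt,
      Matrix.mul_assoc]
  rw [Matrix.map_neg _ (map_neg σ), Matrix.transpose_neg, h1, Matrix.mul_neg, Matrix.neg_mul, neg_neg]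
  calc T⁻¹ * (T * X * T⁻¹) * T = T⁻¹ * T * X * (T⁻¹ * T) := by simp only [Matrix.mul_assoc]
    _ = X := by rw [Matrix.nonsing_inv_mul T hT, Matrix.one_mul, Matrix.mul_one]

variable [Invertible (2 : R)]

/-- **`π X = ½ (X + ι X)` is skew** for every `X`. [cite: HarrisKudlaSweet1996, §1 (1.12)] -/
theorem skew_proj (hT : IsUnit T.det) (hTσ : T.map σ = T) (hTt : Tᵀ = T) (hσ : ∀ x, σ (σ x) = x) (X : Matrix ι ι R) :
    ((⅟(2 : R) • (X + -(T⁻¹ * (X.map σ)ᵀ * T))).map σ)ᵀ * T + T * (⅟(2 : R) • (X + -(T⁻¹ * (X.map σ)ᵀ * T))) = 0 := by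
  rw [skew_iff_eq_neg hT, negConj_smul, HeisRing.map_invOf_two (σ := σ), negConj_add, negConj_negConj hT hTσ hTt hσ, add_comm X]

/-- `π` is the identity on skew matrices. [cite: HarrisKudlaSweet1996, §1 (1.12)] -/
theorem proj_of_skew (hT : IsUnit T.det) {Y : Matrix ι ι R} (hY : (Y.map σ)ᵀ * T + T * Y = 0) :
    ⅟(2 : R) • (Y + -(T⁻¹ * (Y.map σ)ᵀ * T)) = Y := by
  rw [← (skew_iff_eq_neg hT Y).1 hY, ← two_smul R Y, smul_smul, invOf_mul_self, one_smul]

/-- `π` is additive. [folklore] -/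
theorem proj_add (X X' : Matrix ι ι R) :
    ⅟(2 : R) • (X + X' + -(T⁻¹ * ((X + X').map σ)ᵀ * T)) =
      ⅟(2 : R) • (X + -(T⁻¹ * (X.map σ)ᵀ * T)) + ⅟(2 : R) • (X' + -(T⁻¹ * (X'.map σ)ᵀ * T)) := by
  rw [negConj_add, ← smul_add]; congr 1; abel

/-- `π (c • X) = c • π X` for `σ`-fixed `c`. [folklore] -/
theorem proj_smul_of_fixed {c : R} (hc : σ c = c) (X : Matrix ι ι R) :
    ⅟(2 : R) • (c • X + -(T⁻¹ * ((c • X).map σ)ᵀ * T)) = c • (⅟(2 : R) • (X + -(T⁻¹ * (X.map σ)ᵀ * T))) := by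
  rw [negConj_smul, hc, ← smul_add, smul_comm]

/-- `π (d • Y) = 0` for skew `Y` and `σ d = −d`. [folklore] -/
theorem proj_smul_of_anti (hT : IsUnit T.det) {d : R} (hd : σ d = -d) {Y : Matrix ι ι R} (hY : (Y.map σ)ᵀ * T + T * Y = 0) :
    ⅟(2 : R) • (d • Y + -(T⁻¹ * ((d • Y).map σ)ᵀ * T)) = 0 := by
  rw [negConj_smul, hd, ← (skew_iff_eq_neg hT Y).1 hY, neg_smul, add_neg_cancel, smul_zero]

/-- **The squaring decomposition** `X = π X + δ • π (δ' • X)` (`σ δ = −δ`, `σ δ' = −δ'`, `δ δ' = 1`): `M_n = S ⊕ δ S` for the skew matrices `S`.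
[folklore] -/
theorem self_eq_proj_add_smul_proj {δ δ' : R} (hδ' : σ δ' = -δ') (hδδ' : δ * δ' = 1) (X : Matrix ι ι R) :
    X = ⅟(2 : R) • (X + -(T⁻¹ * (X.map σ)ᵀ * T)) + δ • (⅟(2 : R) • (δ' • X + -(T⁻¹ * ((δ' • X).map σ)ᵀ * T))) := by
  rw [negConj_smul, hδ']
  generalize -(T⁻¹ * (X.map σ)ᵀ * T) = Z
  have h2 : δ * (⅟(2 : R) * δ') = ⅟2 := by rw [mul_left_comm, hδδ', mul_one]
  simp only [smul_add, neg_smul, smul_neg, smul_smul, h2]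
  calc X = (⅟(2 : R) + ⅟2) • X := by rw [invOf_two_add_invOf_two, one_smul]
    _ = _ := by rw [add_smul]; abel

/-- **`m(A', D') n(Y) m(A, D) = n(A' Y D)`** for `A' A = 1`, `D' D = 1` (conjugation of the unipotent radical by the Levi).
[cite: HarrisKudlaSweet1996, §1 (1.12)] -/
theorem levi_mul_unip_mul_levi {A A' D D' : Matrix ι ι R} (hA : A' * A = 1) (hD : D' * D = 1) (Y : Matrix ι ι R) :
    cayR R ι * Matrix.fromBlocks A' 0 0 D' * cayRinv R ι * (cayR R ι * Matrix.fromBlocks 1 Y 0 1 * cayRinv R ι) *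
        (cayR R ι * Matrix.fromBlocks A 0 0 D * cayRinv R ι) =
      cayR R ι * Matrix.fromBlocks 1 (A' * Y * D) 0 1 * cayRinv R ι := by
  apply eq_of_adapt_eq
  rw [adapt_mul, adapt_mul, adapt_levi, adapt_unip, adapt_levi, adapt_unip, Matrix.fromBlocks_multiply, Matrix.fromBlocks_multiply]
  simp [hA, hD, Matrix.mul_assoc]

end Ring

/-! ## §2 The unipotent chart of `N_Δ(𝔸)` -/

section Doubled

variable (L : Type) [Field L] [NumberField L] [IsCMField L]
variable {N M n : ℕ} (e : Fin N × Fin M ≃ Fin n)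
  (dV : Fin N → L) (hdV : ∀ i, IsCMField.complexConj L (dV i) = dV i)
  (dW : Fin M → L) (hdW : ∀ i, IsCMField.complexConj L (dW i) = dW i)

/-- **The unipotent element with prescribed skew block**: for skew `Y` there is `u ∈ H(𝔸)` with `blk u = n(Y) = R [[1,Y],[0,1]] R⁻¹`.
[cite: HarrisKudlaSweet1996, §1 (1.12)] -/
theorem exists_unip {Y : Matrix (Fin n) (Fin n) (AdeleRing (𝓞 L) L)}
    (hY : (Y.map (conjAdele (Fp L) L (IsCMField.complexConj L)))ᵀ *
        (gramR L e dV hdV dW hdW).map ((algebraMap L (AdeleRing (𝓞 L) L)).comp (algebraMap (Fp L) L)) +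
      (gramR L e dV hdV dW hdW).map ((algebraMap L (AdeleRing (𝓞 L) L)).comp (algebraMap (Fp L) L)) * Y = 0) :
    ∃ u : HA L e dV hdV dW hdW, blk L e dV hdV dW hdW u =
      cayR (AdeleRing (𝓞 L) L) (Fin n) * Matrix.fromBlocks 1 Y 0 1 * cayRinv (AdeleRing (𝓞 L) L) (Fin n) := by
  refine exists_mem_HA_of_cstar L e dV hdV dW hdW
    (Y := cayR (AdeleRing (𝓞 L) L) (Fin n) * Matrix.fromBlocks 1 (-Y) 0 1 * cayRinv (AdeleRing (𝓞 L) L) (Fin n)) ?_ ?_ ?_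
  · rw [unip_mul_unip, add_neg_cancel, Matrix.fromBlocks_one, Matrix.mul_one, cayR_mul_cayRinv]
  · rw [unip_mul_unip, neg_add_cancel, Matrix.fromBlocks_one, Matrix.mul_one, cayR_mul_cayRinv]
  · exact cstar_unip_of_skew _ _ hY

/-- On `N_Δ(𝔸)` (`blkA = blkD = 1`): `blk u = n(blkB (blk u))`. [cite: HarrisKudlaSweet1996, §1 (1.12)] -/
theorem blk_eq_unip {u : HA L e dV hdV dW hdW} (hP : IsSiegelDelta L e dV hdV dW hdW u)
    (hA : blkA (blk L e dV hdV dW hdW u) = 1) (hD : blkD (blk L e dV hdV dW hdW u) = 1) :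
    blk L e dV hdV dW hdW u = cayR (AdeleRing (𝓞 L) L) (Fin n) * Matrix.fromBlocks 1 (blkB (blk L e dV hdV dW hdW u)) 0 1 *
      cayRinv (AdeleRing (𝓞 L) L) (Fin n) := by
  conv_lhs => rw [eq_conj_fromBlocks_of_blkC_eq_zero ((blkC_eq_zero_iff _).2 hP), hA, hD]

/-- On `N_Δ(𝔸)` the block `blkB (blk u)` is skew (★ `rel₂₂` with `D = 1`). [cite: HarrisKudlaSweet1996, §1 (1.12)] -/
theorem skew_blkB {u : HA L e dV hdV dW hdW} (hD : blkD (blk L e dV hdV dW hdW u) = 1) :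
    ((blkB (blk L e dV hdV dW hdW u)).map (conjAdele (Fp L) L (IsCMField.complexConj L)))ᵀ *
        (gramR L e dV hdV dW hdW).map ((algebraMap L (AdeleRing (𝓞 L) L)).comp (algebraMap (Fp L) L)) +
      (gramR L e dV hdV dW hdW).map ((algebraMap L (AdeleRing (𝓞 L) L)).comp (algebraMap (Fp L) L)) * blkB (blk L e dV hdV dW hdW u) = 0 := by
  have h := rel₂₂ (σ := conjAdele (Fp L) L (IsCMField.complexConj L))
    (T := (gramR L e dV hdV dW hdW).map ((algebraMap L (AdeleRing (𝓞 L) L)).comp (algebraMap (Fp L) L)))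
    (cstar_blk L e dV hdV dW hdW u)
  rw [hD, Matrix.map_one _ (map_zero _) (map_one _), Matrix.transpose_one, Matrix.one_mul, Matrix.mul_one, add_comm] at h
  exact h

omit [IsCMField L] in
/-- The matrix of `z(eˢ) = scalarExp n L s` is the scalar `posRealIdele (eˢ) • 1`. [folklore] -/
theorem coe_scalarExp (s : ℝ) :
    ((scalarExp n L s : GL (Fin n) (AdeleRing (𝓞 L) L)) : Matrix (Fin n) (Fin n) (AdeleRing (𝓞 L) L)) =
      ((posRealIdele L (expUnitNNReal s) : (AdeleRing (𝓞 L) L)ˣ) : AdeleRing (𝓞 L) L) • (1 : Matrix (Fin n) (Fin n) (AdeleRing (𝓞 L) L)) := by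
  rw [scalarExp, posRealScalar, MonoidHom.comp_apply, Matrix.GeneralLinearGroup.coe_scalar, Matrix.scalar_apply, ← Matrix.smul_one_eq_diagonal]

omit [IsCMField L] in
/-- The matrix of `z(eˢ)⁻¹`. [folklore] -/
theorem coe_scalarExp_inv (s : ℝ) :
    (((scalarExp n L s)⁻¹ : GL (Fin n) (AdeleRing (𝓞 L) L)) : Matrix (Fin n) (Fin n) (AdeleRing (𝓞 L) L)) =
      (((posRealIdele L (expUnitNNReal s))⁻¹ : (AdeleRing (𝓞 L) L)ˣ) : AdeleRing (𝓞 L) L) • (1 : Matrix (Fin n) (Fin n) (AdeleRing (𝓞 L) L)) := by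
  rw [scalarExp, posRealScalar, MonoidHom.comp_apply, ← map_inv, Matrix.GeneralLinearGroup.coe_scalar, Matrix.scalar_apply,
    ← Matrix.smul_one_eq_diagonal]

set_option maxHeartbeats 400000 in
/-- **THE UNIPOTENT CHART `υ` of `N_Δ(𝔸)`.**  Let `(M_Δ, N_Δ, e, φ)` be a Siegel–Levi chart of `P_Δ(𝔸)` (★ `exists_siegelLeviChart`, through its
characterisation: `N_Δ = {blkA ∘ blk = 1}`, `blkD ∘ blk = 1` on `N_Δ`, `blk (φ g) = m(g)`).  Then there is a continuous
`υ : M_n(𝔸_L) → N_Δ` with `blk (υ X) = n(π X)` (so `blkB (blk (υ X)) = π X`), `υ (X + X') = υ X · υ X'`, `υ (blkB (blk u)) = u` for `u ∈ N_Δ`, and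
`(φ z(eˢ))⁻¹ υ(X) (φ z(eˢ)) = υ (c_s⁻¹ • X)` with `c_s = r · (c ⊗ 1) r`, `r = posRealIdele (eˢ)`.
[cite: HarrisKudlaSweet1996, §1 (1.11)–(1.12)] [cite: Garrett2018, §3.10] -/
theorem exists_unipotentChart (hdV0 : ∀ i, dV i ≠ 0) (hdW0 : ∀ i, dW i ≠ 0)
    {Mg Ng : Subgroup (siegelDelta L e dV hdV dW hdW : Subgroup (HA L e dV hdV dW hdW))}
    {eMN : ↥Mg × ↥Ng ≃ₜ (siegelDelta L e dV hdV dW hdW : Subgroup (HA L e dV hdV dW hdW))}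
    (hS : IsTopSemidirect Mg Ng eMN) (φ : GL (Fin n) (AdeleRing (𝓞 L) L) ≃ₜ* ↥Mg)
    (hNg : ∀ p : (siegelDelta L e dV hdV dW hdW : Subgroup (HA L e dV hdV dW hdW)),
      p ∈ Ng ↔ blkA (blk L e dV hdV dW hdW (p : HA L e dV hdV dW hdW)) = 1)
    (hNgD : ∀ p : (siegelDelta L e dV hdV dW hdW : Subgroup (HA L e dV hdV dW hdW)),
      p ∈ Ng → blkD (blk L e dV hdV dW hdW (p : HA L e dV hdV dW hdW)) = 1)
    (hφ : ∀ g : GL (Fin n) (AdeleRing (𝓞 L) L),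
      blk L e dV hdV dW hdW (((φ g : ↥Mg) : (siegelDelta L e dV hdV dW hdW : Subgroup (HA L e dV hdV dW hdW))) : HA L e dV hdV dW hdW) =
        cayR (AdeleRing (𝓞 L) L) (Fin n) * Matrix.fromBlocks (g : Matrix (Fin n) (Fin n) (AdeleRing (𝓞 L) L)) 0 0
          (((gramR L e dV hdV dW hdW).map ((algebraMap L (AdeleRing (𝓞 L) L)).comp (algebraMap (Fp L) L)))⁻¹ *
            (((g⁻¹ : GL (Fin n) (AdeleRing (𝓞 L) L)) : Matrix (Fin n) (Fin n) (AdeleRing (𝓞 L) L)).map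
              (conjAdele (Fp L) L (IsCMField.complexConj L)))ᵀ *
            (gramR L e dV hdV dW hdW).map ((algebraMap L (AdeleRing (𝓞 L) L)).comp (algebraMap (Fp L) L))) *
          cayRinv (AdeleRing (𝓞 L) L) (Fin n)) :
    ∃ υ : Matrix (Fin n) (Fin n) (AdeleRing (𝓞 L) L) → ↥Ng, Continuous υ ∧
      (∀ X, blk L e dV hdV dW hdW (((υ X : ↥Ng) : (siegelDelta L e dV hdV dW hdW : Subgroup (HA L e dV hdV dW hdW))) : HA L e dV hdV dW hdW) =
        cayR (AdeleRing (𝓞 L) L) (Fin n) * Matrix.fromBlocks 1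
          (⅟(2 : AdeleRing (𝓞 L) L) • (X + -(((gramR L e dV hdV dW hdW).map ((algebraMap L (AdeleRing (𝓞 L) L)).comp (algebraMap (Fp L) L)))⁻¹ *
            (X.map (conjAdele (Fp L) L (IsCMField.complexConj L)))ᵀ *
            (gramR L e dV hdV dW hdW).map ((algebraMap L (AdeleRing (𝓞 L) L)).comp (algebraMap (Fp L) L))))) 0 1 *
          cayRinv (AdeleRing (𝓞 L) L) (Fin n)) ∧
      (∀ X X', υ (X + X') = υ X * υ X') ∧
      (∀ u : ↥Ng, υ (blkB (blk L e dV hdV dW hdW ((u : (siegelDelta L e dV hdV dW hdW : Subgroup (HA L e dV hdV dW hdW))) : HA L e dV hdV dW hdW))) = u) ∧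
      (∀ (s : ℝ) (X : Matrix (Fin n) (Fin n) (AdeleRing (𝓞 L) L)),
        hS.conjBy (φ (scalarExp n L s)) (υ X) =
          υ ((((posRealIdele L (expUnitNNReal s) *
              Units.map (conjAdele (Fp L) L (IsCMField.complexConj L) : AdeleRing (𝓞 L) L →* AdeleRing (𝓞 L) L)
                (posRealIdele L (expUnitNNReal s)))⁻¹ : (AdeleRing (𝓞 L) L)ˣ) : AdeleRing (𝓞 L) L) • X)) := by
  classical
  -- abbreviations (local hypotheses, not definitions)
  set σ : AdeleRing (𝓞 L) L →+* AdeleRing (𝓞 L) L := conjAdele (Fp L) L (IsCMField.complexConj L) with hσdef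
  set T : Matrix (Fin n) (Fin n) (AdeleRing (𝓞 L) L) :=
    (gramR L e dV hdV dW hdW).map ((algebraMap L (AdeleRing (𝓞 L) L)).comp (algebraMap (Fp L) L)) with hTdef
  have hT : IsUnit T.det := isUnit_det_gramRA L e dV hdV dW hdW hdV0 hdW0
  have hTσ : T.map σ = T := gramRA_map_conjAdele L e dV hdV dW hdW
  have hTt : Tᵀ = T := gramRA_transpose L e dV hdV dW hdW
  have hσσ : ∀ x, σ (σ x) = x := conjAdele_conjAdele' L
  -- the projection `π`
  set π : Matrix (Fin n) (Fin n) (AdeleRing (𝓞 L) L) → Matrix (Fin n) (Fin n) (AdeleRing (𝓞 L) L) :=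
    fun X => ⅟(2 : AdeleRing (𝓞 L) L) • (X + -(T⁻¹ * (X.map σ)ᵀ * T)) with hπ
  have hπskew : ∀ X, ((π X).map σ)ᵀ * T + T * π X = 0 := fun X => skew_proj hT hTσ hTt hσσ X
  -- the unipotent element with block `π X`
  choose υ₀ hυ₀ using fun X : Matrix (Fin n) (Fin n) (AdeleRing (𝓞 L) L) => exists_unip L e dV hdV dW hdW (hπskew X)
  have hυ₀P : ∀ X, υ₀ X ∈ siegelDelta L e dV hdV dW hdW := fun X =>
    (mem_siegelDelta_iff L e dV hdV dW hdW _).2 ((blkC_eq_zero_iff _).1 (by rw [hυ₀]; exact (blk_unip _).2.2.1))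
  have hυ₀N : ∀ X, (⟨υ₀ X, hυ₀P X⟩ : (siegelDelta L e dV hdV dW hdW : Subgroup (HA L e dV hdV dW hdW))) ∈ Ng := fun X => by
    rw [hNg]
    change blkA (blk L e dV hdV dW hdW (υ₀ X)) = 1
    rw [hυ₀]; exact (blk_unip _).1
  set υ : Matrix (Fin n) (Fin n) (AdeleRing (𝓞 L) L) → ↥Ng := fun X => ⟨⟨υ₀ X, hυ₀P X⟩, hυ₀N X⟩ with hυdef
  have hυcoe : ∀ X, (((υ X : ↥Ng) : (siegelDelta L e dV hdV dW hdW : Subgroup (HA L e dV hdV dW hdW))) : HA L e dV hdV dW hdW) = υ₀ X :=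
    fun X => rfl
  -- injectivity through the coercions
  have hext : ∀ {a b : ↥Ng}, ((a : (siegelDelta L e dV hdV dW hdW : Subgroup (HA L e dV hdV dW hdW))) : HA L e dV hdV dW hdW) =
      ((b : (siegelDelta L e dV hdV dW hdW : Subgroup (HA L e dV hdV dW hdW))) : HA L e dV hdV dW hdW) → a = b :=
    fun h => Subtype.ext (Subtype.ext h)
  -- additivity
  have hadd : ∀ X X', υ (X + X') = υ X * υ X' := by
    intro X X'
    apply hext
    apply blk_injective L e dV hdV dW hdW
    rw [hυcoe, Subgroup.coe_mul, Subgroup.coe_mul, blk_mul, hυcoe, hυcoe, hυ₀, hυ₀, hυ₀, unip_mul_unip, hπ]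
    dsimp only
    rw [proj_add]
  refine ⟨υ, ?_, fun X => by simp only [hυcoe, hυ₀, hπ], hadd, fun u => ?_, fun s X => ?_⟩
  · -- continuity: matrix and inverse matrix of `υ₀ X` are continuous in `X`
    have hσc : Continuous σ := continuous_conjAdele (Fp L) L _
    have hιc : Continuous fun X : Matrix (Fin n) (Fin n) (AdeleRing (𝓞 L) L) => -(T⁻¹ * (X.map σ)ᵀ * T) :=
      (Continuous.matrix_mul (Continuous.matrix_mul continuous_const
        ((@continuous_id (Matrix (Fin n) (Fin n) (AdeleRing (𝓞 L) L)) _).matrix_map hσc).matrix_transpose) continuous_const).neg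
    have hπc : Continuous π := by
      rw [hπ]
      exact ((@continuous_id (Matrix (Fin n) (Fin n) (AdeleRing (𝓞 L) L)) _).add hιc).const_smul (⅟(2 : AdeleRing (𝓞 L) L))
    have hmatc : Continuous fun X : Matrix (Fin n) (Fin n) (AdeleRing (𝓞 L) L) =>
        ((υ₀ X : GL (Fin (n + n)) (AdeleRing (𝓞 L) L)) : Matrix (Fin (n + n)) (Fin (n + n)) (AdeleRing (𝓞 L) L)) := by
      have hmat : ∀ X, ((υ₀ X : GL (Fin (n + n)) (AdeleRing (𝓞 L) L)) : Matrix (Fin (n + n)) (Fin (n + n)) (AdeleRing (𝓞 L) L)) =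
          Matrix.reindex (e₂ (n := n)) (e₂ (n := n)) (cayR (AdeleRing (𝓞 L) L) (Fin n) * Matrix.fromBlocks 1 (π X) 0 1 *
            cayRinv (AdeleRing (𝓞 L) L) (Fin n)) := fun X => by
        rw [← hυ₀ X]; exact (reindex_reindex_symm _).symm
      simp_rw [hmat, Matrix.reindex_apply]
      refine Continuous.matrix_submatrix ?_ _ _
      refine Continuous.matrix_mul (Continuous.matrix_mul continuous_const ?_) continuous_const
      exact Continuous.matrix_fromBlocks continuous_const hπc continuous_const continuous_const
    have hinv : ∀ X, (υ₀ X)⁻¹ = υ₀ (-X) := by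
      intro X
      refine (eq_inv_of_mul_eq_one_left ?_).symm
      apply blk_injective L e dV hdV dW hdW
      rw [blk_mul, hυ₀, hυ₀, unip_mul_unip, blk_one, hπ]
      dsimp only
      rw [← proj_add, neg_add_cancel, Matrix.map_zero _ (map_zero σ), Matrix.transpose_zero, Matrix.mul_zero, Matrix.zero_mul, neg_zero,
        add_zero, smul_zero, Matrix.fromBlocks_one, Matrix.mul_one, cayR_mul_cayRinv]
    refine continuous_induced_rng.2 (continuous_induced_rng.2 (continuous_induced_rng.2 (Units.continuous_iff.2 ⟨hmatc, ?_⟩)))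
    have h2 : ∀ X, (((υ₀ X : GL (Fin (n + n)) (AdeleRing (𝓞 L) L))⁻¹ : GL (Fin (n + n)) (AdeleRing (𝓞 L) L)) :
        Matrix (Fin (n + n)) (Fin (n + n)) (AdeleRing (𝓞 L) L)) =
        ((υ₀ (-X) : GL (Fin (n + n)) (AdeleRing (𝓞 L) L)) : Matrix (Fin (n + n)) (Fin (n + n)) (AdeleRing (𝓞 L) L)) := fun X => by
      rw [← hinv]; rfl
    change Continuous fun X => (((υ₀ X : GL (Fin (n + n)) (AdeleRing (𝓞 L) L))⁻¹ : GL (Fin (n + n)) (AdeleRing (𝓞 L) L)) :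
        Matrix (Fin (n + n)) (Fin (n + n)) (AdeleRing (𝓞 L) L))
    simp_rw [h2]
    exact hmatc.comp continuous_neg
  · -- `υ (blkB (blk u)) = u` on `N_Δ`
    have huP : IsSiegelDelta L e dV hdV dW hdW ((u : (siegelDelta L e dV hdV dW hdW : Subgroup (HA L e dV hdV dW hdW))) : HA L e dV hdV dW hdW) :=
      (mem_siegelDelta_iff L e dV hdV dW hdW _).1 (u : (siegelDelta L e dV hdV dW hdW : Subgroup (HA L e dV hdV dW hdW))).2
    have huA := (hNg _).1 u.2
    have huD := hNgD _ u.2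
    apply hext
    apply blk_injective L e dV hdV dW hdW
    rw [hυcoe, hυ₀]
    conv_rhs => rw [blk_eq_unip L e dV hdV dW hdW huP huA huD]
    rw [hπ]
    dsimp only
    rw [proj_of_skew hT (skew_blkB L e dV hdV dW hdW huD)]
  · -- the centre action
    set r : (AdeleRing (𝓞 L) L)ˣ := posRealIdele L (expUnitNNReal s) with hr
    set c : (AdeleRing (𝓞 L) L)ˣ := r * Units.map (σ : AdeleRing (𝓞 L) L →* AdeleRing (𝓞 L) L) r with hc
    have hcinv : ((c⁻¹ : (AdeleRing (𝓞 L) L)ˣ) : AdeleRing (𝓞 L) L) =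
        σ (((r⁻¹ : (AdeleRing (𝓞 L) L)ˣ)) : AdeleRing (𝓞 L) L) * ((r⁻¹ : (AdeleRing (𝓞 L) L)ˣ) : AdeleRing (𝓞 L) L) := by
      rw [hc, mul_inv_rev, Units.val_mul, Units.coe_map_inv, MonoidHom.coe_coe]
    have hcσ : σ ((c⁻¹ : (AdeleRing (𝓞 L) L)ˣ) : AdeleRing (𝓞 L) L) = ((c⁻¹ : (AdeleRing (𝓞 L) L)ˣ) : AdeleRing (𝓞 L) L) := by
      rw [hcinv, map_mul, hσσ, mul_comm]
    apply hext
    apply blk_injective L e dV hdV dW hdW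
    -- the left side: `blk (a⁻¹ u a) = m(z⁻¹) n(π X) m(z)`
    have hconj : (((hS.conjBy (φ (scalarExp n L s)) (υ X) : ↥Ng) : (siegelDelta L e dV hdV dW hdW : Subgroup (HA L e dV hdV dW hdW))) :
        HA L e dV hdV dW hdW) =
        (((φ (scalarExp n L s)⁻¹ : ↥Mg) : (siegelDelta L e dV hdV dW hdW : Subgroup (HA L e dV hdV dW hdW))) : HA L e dV hdV dW hdW) *
          υ₀ X * (((φ (scalarExp n L s) : ↥Mg) : (siegelDelta L e dV hdV dW hdW : Subgroup (HA L e dV hdV dW hdW))) : HA L e dV hdV dW hdW) := by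
      simp only [IsTopSemidirect.conjBy, map_inv, Subgroup.coe_mul, Subgroup.coe_inv, hυcoe]
    rw [hconj, blk_mul, blk_mul, hφ, hφ, hυcoe, hυ₀, hυ₀, inv_inv, coe_scalarExp, coe_scalarExp_inv]
    -- the blocks of `m(z)` and `m(z⁻¹)` are scalars
    have hsc : ∀ a : (AdeleRing (𝓞 L) L)ˣ, T⁻¹ * (((a : AdeleRing (𝓞 L) L) • (1 : Matrix (Fin n) (Fin n) (AdeleRing (𝓞 L) L))).map σ)ᵀ * T =
        σ a • (1 : Matrix (Fin n) (Fin n) (AdeleRing (𝓞 L) L)) := fun a => by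
      rw [map_smul_eq, Matrix.map_one σ (map_zero σ) (map_one σ), Matrix.transpose_smul, Matrix.transpose_one, Matrix.mul_smul, Matrix.mul_one,
        Matrix.smul_mul, Matrix.nonsing_inv_mul T hT]
    have hA' : ((r⁻¹ : (AdeleRing (𝓞 L) L)ˣ) : AdeleRing (𝓞 L) L) • (1 : Matrix (Fin n) (Fin n) (AdeleRing (𝓞 L) L)) *
        ((r : AdeleRing (𝓞 L) L) • (1 : Matrix (Fin n) (Fin n) (AdeleRing (𝓞 L) L))) = 1 := by
      rw [Matrix.smul_mul, Matrix.one_mul, smul_smul, ← Units.val_mul, inv_mul_cancel, Units.val_one, one_smul]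
    have hD' : σ (r : AdeleRing (𝓞 L) L) • (1 : Matrix (Fin n) (Fin n) (AdeleRing (𝓞 L) L)) *
        (σ ((r⁻¹ : (AdeleRing (𝓞 L) L)ˣ) : AdeleRing (𝓞 L) L) • (1 : Matrix (Fin n) (Fin n) (AdeleRing (𝓞 L) L))) = 1 := by
      rw [Matrix.smul_mul, Matrix.one_mul, smul_smul, ← map_mul, ← Units.val_mul, mul_inv_cancel, Units.val_one, map_one, one_smul]
    have hblk : ((r⁻¹ : (AdeleRing (𝓞 L) L)ˣ) : AdeleRing (𝓞 L) L) • (1 : Matrix (Fin n) (Fin n) (AdeleRing (𝓞 L) L)) * π X *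
        (σ ((r⁻¹ : (AdeleRing (𝓞 L) L)ˣ) : AdeleRing (𝓞 L) L) • (1 : Matrix (Fin n) (Fin n) (AdeleRing (𝓞 L) L))) =
        π (((c⁻¹ : (AdeleRing (𝓞 L) L)ˣ) : AdeleRing (𝓞 L) L) • X) := by
      rw [Matrix.smul_mul, Matrix.one_mul, Matrix.mul_smul, Matrix.mul_one, smul_smul, ← hcinv, hπ]
      dsimp only
      rw [proj_smul_of_fixed hcσ]
    rw [← hr, hsc, hsc, levi_mul_unip_mul_levi hA' hD', hblk]

end Doubled

end Summit.HodgeConjecture.HodgeConjecture.Cruxes.HLiu418.K2LiuSiegelDoubledUnipotentChart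

end
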